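import Mathlib
import Summits.ResolutionOfSingularities.ResolutionOfSingularities.Theorems.HomologicalConductorPersistenceStaircaseRecords
import Summits.ResolutionOfSingularities.ResolutionOfSingularities.Theorems.HomologicalConductorPersistenceCyclicQuotientOneModQ
import HarnessLib

/-!
# Rung S-2 `PersistenceSurface` (stmt-19970), stub C1 (`Sat₄`) — the family `1/n(1,q)`, `n = bq − 2` (`q` odd ≥ 5),
# PART A: the ring identities and the COVER PROPERTY of its parametric record staircase
# (chain W4.4b; T-V package, part 29a; seat leafhand-res-homologicalconduct-10 gen 2)

[OURS · L1 w44b · rung S-2] Nothing here is a statement of the manuscript under review (Hironaka 2017);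
AI-written, weaker than expert review.

Parts 27/28 certified `n ≡ ±1 (mod q)`.  This file does `n ≡ −2 (mod q)`: `U = k[u,v]^{μ_n(1,q)}`, `n = bq − 2`, `b ≥ 2`, `q ≥ 5` odd
(`ζ` a primitive `n`-th root of unity, `n ∈ kˣ`); `n/q = [b, (q+1)/2, 2]`, `e = 3`, `i`-series `(q, 2, 1)`, cospecial pieces
`M_{−q}, M_{−2}, M_{−1}` (the case `q = 3` is `n ≡ 1 (mod 3)`, part 27).  It is the first family whose record staircase needs
the TWO-LEVEL recursion of the hand memo HAND10G2-TORIC-FAMILIES §1 (`drops_{(n,q)}(α) = q^{⌊α/q⌋} ++ drops_{(q,2)}(α mod q)`): for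
a class `a` with `a.val = α = qA + ρ`, `ρ = 2A' + ρ'`,

* `u^{α − qs} v^{s}` (`s ≤ A`, drops `q`), then `u^{ρ − 2s'} v^{A + bs'}` (`1 ≤ s' ≤ A'`, drops `2`), then — when `ρ` is odd — the
  generator `v^{J}`, `J = A + bA' + (b − 1) + b(q−1)/2` (from `u v^{A+bA'}` the orbit climbs to `q − 1` and descends by `2`):
  one drop `1`; so `Ω M_a ≅ M_{−q}^{A} ⊕ M_{−2}^{A'} ⊕ M_{−1}^{ρ'}`;
* Ω-stability: `M_{−q} | Ω M_{−1}` (position `0`), `M_{−2} | Ω M_{−q}` (position `b − 2`), `M_{−1} | Ω M_{−q}`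
  (position `b − 2 + (q−3)/2`);
* this file (part A): the four ring identities `stair2_identity`, `drop2_identity`, `stair3_identity`, `cover3_identity` and the
  cover property `cover_minusTwo_mod_q` (regimes 1–3, wrap certificates `v + q·i = α + W·n` with three sub-cases in regime 3);
  part B (`…CyclicQuotientMinusTwoModQ`) assembles **`cohomologyAnnihilator_minusTwo_mod_q`**.

References: folklore (Auslander 1986 / Herzog 1978 mechanism; Wunram 1988, Riemenschneider 1974); hand memo HAND10G2-TORIC-FAMILIES
(OURS, evidence on stmt-19970).
-/

-- single-problem summit: the doubled namespace component `ResolutionOfSingularities` is forced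
set_option linter.dupNamespace false

noncomputable section

open CategoryTheory Literature.RingTheory.CohomologyAnnihilator MvPolynomial
open Summit.ResolutionOfSingularities.ResolutionOfSingularities.Theorems.NoZeno.SandwichCluster
open Summit.ResolutionOfSingularities.ResolutionOfSingularities.Theorems.HomologicalConductor.PersistenceAddCoverFamily
open Summit.ResolutionOfSingularities.ResolutionOfSingularities.Theorems.HomologicalConductor.PersistenceCyclicQuotientIsotypic
open Summit.ResolutionOfSingularities.ResolutionOfSingularities.Theorems.HomologicalConductor.PersistenceCyclicQuotientIsotypicPieces
open Summit.ResolutionOfSingularities.ResolutionOfSingularities.Theorems.HomologicalConductor.PersistenceStaircaseRecords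
open Summit.ResolutionOfSingularities.ResolutionOfSingularities.Theorems.HomologicalConductor.PersistenceCyclicQuotientOneModQ
  (natCast_val_add_mul_self val_sub_natCast_eq val_neg_natCast)

universe u

namespace Summit.ResolutionOfSingularities.ResolutionOfSingularities.Theorems.HomologicalConductor.PersistenceCyclicQuotientMinusTwoModQ

/-! ## Arithmetic: the five ring identities -/

/-- Regime 2 generators: `(ρ − 2s) + q (A + b s) = (qA + ρ) + s (bq − 2)`. [folklore] -/
theorem stair2_identity (q b A ρ s : ℕ) (hs : 2 * s ≤ ρ) (hbq : 2 ≤ b * q) :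
    ρ - 2 * s + q * (A + b * s) = q * A + ρ + s * (b * q - 2) := by
  zify [hs, hbq]
  ring

/-- Regime 2 drops: `(ρ − 2t) + q (A + b (t+1)) = (qA + ρ) + (t+1)(bq − 2) + 2`. [folklore] -/
theorem drop2_identity (q b A ρ t : ℕ) (ht : 2 * t + 2 ≤ ρ) (hbq : 2 ≤ b * q) :
    ρ - 2 * t + q * (A + b * (t + 1)) = q * A + ρ + (t + 1) * (b * q - 2) + 2 := by
  zify [(by omega : 2 * t ≤ ρ), hbq]
  ring

/-- The closing generator (odd `ρ = 2A' + 1`, `q = 2h + 1`):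
`q (A + b A' + (b − 1) + b h) = (qA + 2A' + 1) + (A' + h + 1)(bq − 2)`. [folklore] -/
theorem stair3_identity (q b A A' h : ℕ) (hqh : q = 2 * h + 1) (hb : 1 ≤ b) (hbq : 2 ≤ b * q) :
    q * (A + b * A' + (b - 1) + b * h) = q * A + 2 * A' + 1 + (A' + h + 1) * (b * q - 2) := by
  zify [hb, hbq]
  subst hqh
  push_cast
  ring

/-- Cover certificate in the last regime at a small value `q − 1 − 2m` (position `A + bA' + (b−1) + bm`):
`(q − 1 − 2m) + q (A + bA' + (b−1) + bm) = (qA + 2A' + 1) + (A' + 1 + m)(bq − 2)`. [folklore] -/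
theorem cover3_identity (q b A A' m : ℕ) (hm : 2 * m + 1 ≤ q) (hb : 1 ≤ b) (hbq : 2 ≤ b * q) :
    q - 1 - 2 * m + q * (A + b * A' + (b - 1) + b * m) = q * A + 2 * A' + 1 + (A' + 1 + m) * (b * q - 2) := by
  zify [hm, hb, hbq, (by omega : 1 ≤ q), (by omega : 2 * m ≤ q - 1)]
  ring

/-! ## The cover property of the parametric staircase (pure arithmetic in `ZMod n`) -/

/-- **Cover property** of the record staircase of a class `a` for `n = bq − 2` (`q = 2h+1 ≥ 5`, `b ≥ 2`): every orbit position
`i ≤ J` is dominated by a generator `(c_s, j_s)` with `j_s ≤ i` and `c_s ≤ (a − q i).val` — regime 1 (`i ≤ A`), regime 2 (between the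
`2`-drops, wrap certificate `W = s' + 1`), regime 3 (odd `ρ`: three sub-cases of the climb `1 ↦ q−1 ↦ q−3 ↦ … ↦ 0`). Stated with the
staircase functions written out, exactly as consumed by `isotypic_le_span_of_cover`. [OURS · L1 w44b] -/
theorem cover_minusTwo_mod_q {n : ℕ} [NeZero n] {q b h : ℕ} (hqh : q = 2 * h + 1) (hb : 2 ≤ b) (hq : 5 ≤ q)
    (hnq : n = b * q - 2) (a : ZMod n) (i : ℕ)
    (hi : i ≤ (if a.val % q % 2 = 1 then a.val / q + b * (a.val % q / 2) + (b - 1) + b * h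
      else a.val / q + b * (a.val % q / 2))) :
    ∃ s, s ≤ a.val / q + a.val % q / 2 + a.val % q % 2 ∧
      (if s ≤ a.val / q then s else if s ≤ a.val / q + a.val % q / 2 then a.val / q + b * (s - a.val / q)
        else (if a.val % q % 2 = 1 then a.val / q + b * (a.val % q / 2) + (b - 1) + b * h
          else a.val / q + b * (a.val % q / 2))) ≤ i ∧
      (if s ≤ a.val / q then a.val - q * s else if s ≤ a.val / q + a.val % q / 2 then a.val % q - 2 * (s - a.val / q)
        else 0) ≤ ((a - ((q * i : ℕ) : ZMod n) : ZMod n)).val := by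
  have hh : 2 ≤ h := by omega
  have hbq : 2 * q ≤ b * q := Nat.mul_le_mul_right q hb
  have hbq2 : 2 ≤ b * q := by omega
  have hA : q * (a.val / q) + a.val % q = a.val := Nat.div_add_mod _ _
  have hρq : a.val % q < q := Nat.mod_lt _ (by omega)
  have hlt : a.val < n := ZMod.val_lt a

  by_cases hiA : i ≤ a.val / q
  · have := Nat.mul_le_mul_left q hiA
    refine ⟨i, by omega, ?_, ?_⟩
    · rw [if_pos hiA]
    · rw [if_pos hiA, val_sub_natCast_eq a (v := a.val - q * i) (w := 0) (by omega) (by omega)]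
  · by_cases hiP : i ≤ a.val / q + b * (a.val % q / 2)
    · -- regime 2: `i = A + b s' + δ`
      obtain ⟨m₀, hm₀⟩ := Nat.exists_eq_add_of_le (le_of_not_ge hiA)
      obtain ⟨s', δ, hsδ, hδb⟩ : ∃ s' δ : ℕ, b * s' + δ = m₀ ∧ δ < b :=
        ⟨m₀ / b, m₀ % b, Nat.div_add_mod _ _, Nat.mod_lt _ (by omega)⟩
      have hs'A : s' ≤ a.val % q / 2 := by
        by_contra hlt'
        have h' := Nat.mul_le_mul_left b (show a.val % q / 2 + 1 ≤ s' by omega)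
        rw [Nat.mul_succ] at h'
        omega
      by_cases hδ0 : δ = 0
      · -- on the generator `u^{ρ−2s'} v^{A+bs'}`
        have hs'1 : 1 ≤ s' := by
          by_contra h0
          have : s' = 0 := by omega
          subst this; omega
        have hjs : (if a.val / q + s' ≤ a.val / q then a.val / q + s'
            else if a.val / q + s' ≤ a.val / q + a.val % q / 2 then a.val / q + b * (a.val / q + s' - a.val / q)
            else if a.val % q % 2 = 1 then a.val / q + b * (a.val % q / 2) + (b - 1) + b * h
            else a.val / q + b * (a.val % q / 2)) = a.val / q + b * s' := by
          rw [if_neg (by omega), if_pos (by omega), show a.val / q + s' - a.val / q = s' by omega]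
        have hcs : (if a.val / q + s' ≤ a.val / q then a.val - q * (a.val / q + s')
            else if a.val / q + s' ≤ a.val / q + a.val % q / 2 then a.val % q - 2 * (a.val / q + s' - a.val / q)
            else 0) = a.val % q - 2 * s' := by
          rw [if_neg (by omega), if_pos (by omega), show a.val / q + s' - a.val / q = s' by omega]
        refine ⟨a.val / q + s', by omega, ?_, ?_⟩
        · rw [hjs]; omega
        · rw [hcs]
          have hid := stair2_identity q b (a.val / q) (a.val % q) s' (by omega) hbq2
          rw [hA, ← hnq] at hid
          rw [val_sub_natCast_eq a (v := a.val % q - 2 * s') (w := s') (by omega)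
            (by rw [hm₀, show a.val / q + m₀ = a.val / q + b * s' by omega]; exact hid)]
      · -- strictly between two regime-2 generators: value `ρ − 2s' + n − qδ`
        have hs'lt : s' < a.val % q / 2 := by
          by_contra hge
          have : s' = a.val % q / 2 := by omega
          subst this; omega
        have hjs : (if a.val / q + s' ≤ a.val / q then a.val / q + s'
            else if a.val / q + s' ≤ a.val / q + a.val % q / 2 then a.val / q + b * (a.val / q + s' - a.val / q)
            else if a.val % q % 2 = 1 then a.val / q + b * (a.val % q / 2) + (b - 1) + b * h
            else a.val / q + b * (a.val % q / 2)) = a.val / q + b * s' := by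
          by_cases hs'0 : s' = 0
          · subst hs'0; rw [Nat.add_zero, if_pos le_rfl, Nat.mul_zero, Nat.add_zero]
          · rw [if_neg (by omega), if_pos (by omega), show a.val / q + s' - a.val / q = s' by omega]
        have hcs : (if a.val / q + s' ≤ a.val / q then a.val - q * (a.val / q + s')
            else if a.val / q + s' ≤ a.val / q + a.val % q / 2 then a.val % q - 2 * (a.val / q + s' - a.val / q)
            else 0) = a.val % q - 2 * s' := by
          by_cases hs'0 : s' = 0
          · subst hs'0; rw [Nat.add_zero, if_pos le_rfl]; omega
          · rw [if_neg (by omega), if_pos (by omega), show a.val / q + s' - a.val / q = s' by omega]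
        refine ⟨a.val / q + s', by omega, ?_, ?_⟩
        · rw [hjs]; omega
        · rw [hcs]
          have hid := drop2_identity q b (a.val / q) (a.val % q) s' (by omega) hbq2
          rw [hA, ← hnq] at hid
          -- `(ρ − 2s') + q(A + b(s'+1)) = α + (s'+1) n + 2`; subtract `q (b − δ)` worth: value `ρ − 2s' + n − qδ`
          have hqδ : q * δ + q * (b - δ) = b * q := by rw [← Nat.mul_add, Nat.add_sub_cancel' hδb.le, Nat.mul_comm]
          have hqd1 : q ≤ q * δ := Nat.le_mul_of_pos_right q (by omega)
          have hqbd : q ≤ q * (b - δ) := Nat.le_mul_of_pos_right q (by omega)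
          have hsplit : q * (a.val / q + b * (s' + 1)) = q * (a.val / q + (b * s' + δ)) + q * (b - δ) := by
            rw [← Nat.mul_add]; congr 1; rw [Nat.mul_succ]; omega
          rw [val_sub_natCast_eq a (v := a.val % q - 2 * s' + n - q * δ) (w := s' + 1) (by omega)
            (by rw [hm₀, ← hsδ]; omega)]
          omega
    · -- regime 3 (odd `ρ`): beyond `P = A + bA'`
      have hodd : a.val % q % 2 = 1 := by
        by_contra hev
        rw [if_neg hev] at hi
        exact hiP hi
      rw [if_pos hodd] at hi
      by_cases hiJ : i = a.val / q + b * (a.val % q / 2) + (b - 1) + b * h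
      · refine ⟨a.val / q + a.val % q / 2 + 1, by omega, ?_, ?_⟩
        · rw [if_neg (by omega), if_neg (by omega), if_pos hodd]; omega
        · rw [if_neg (by omega), if_neg (by omega)]; exact Nat.zero_le _
      · -- the generator `u v^{P}` covers: value `≥ 1`
        have hjs : (if a.val / q + a.val % q / 2 ≤ a.val / q then a.val / q + a.val % q / 2
            else if a.val / q + a.val % q / 2 ≤ a.val / q + a.val % q / 2
              then a.val / q + b * (a.val / q + a.val % q / 2 - a.val / q)
            else if a.val % q % 2 = 1 then a.val / q + b * (a.val % q / 2) + (b - 1) + b * h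
            else a.val / q + b * (a.val % q / 2)) = a.val / q + b * (a.val % q / 2) := by
          by_cases hA'0 : a.val % q / 2 = 0
          · rw [hA'0, Nat.add_zero, if_pos le_rfl, Nat.mul_zero, Nat.add_zero]
          · rw [if_neg (by omega), if_pos le_rfl, show a.val / q + a.val % q / 2 - a.val / q = a.val % q / 2 by omega]
        have hcs : (if a.val / q + a.val % q / 2 ≤ a.val / q then a.val - q * (a.val / q + a.val % q / 2)
            else if a.val / q + a.val % q / 2 ≤ a.val / q + a.val % q / 2
              then a.val % q - 2 * (a.val / q + a.val % q / 2 - a.val / q) else 0) = 1 := by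
          by_cases hA'0 : a.val % q / 2 = 0
          · rw [hA'0, Nat.add_zero, if_pos le_rfl]; omega
          · rw [if_neg (by omega), if_pos le_rfl]; omega
        refine ⟨a.val / q + a.val % q / 2, by omega, ?_, ?_⟩
        · rw [hjs]; omega
        · rw [hcs]
          -- position `i = P + δ₀`, `1 ≤ δ₀ < (b−1) + b h`
          obtain ⟨δ₀, hδ₀⟩ := Nat.exists_eq_add_of_lt (lt_of_not_ge hiP)
          -- `i = P + δ₀ + 1`
          have hP := stair2_identity q b (a.val / q) (a.val % q) (a.val % q / 2) (by omega) hbq2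
          rw [hA, ← hnq] at hP
          -- `q P = α − 1 + A' n`  (ρ = 2A' + 1)
          have hqP : q * (a.val / q + b * (a.val % q / 2)) + 1 = a.val + (a.val % q / 2) * n := by omega
          by_cases hcase : δ₀ + 1 ≤ b - 2
          · -- (A) first wrap segment: value `1 + n − q(δ₀+1)`
            have hqd : q * (δ₀ + 1) ≤ q * (b - 2) := Nat.mul_le_mul_left q hcase
            have hqb2 : q * (b - 2) + 2 * q = b * q := by
              rw [show 2 * q = q * 2 by ring, ← Nat.mul_add, Nat.sub_add_cancel hb, Nat.mul_comm]
            have hq1 : q ≤ q * (δ₀ + 1) := Nat.le_mul_of_pos_right q (by omega)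
            have hw : (a.val % q / 2 + 1) * n = a.val % q / 2 * n + n := by ring
            rw [val_sub_natCast_eq a (v := 1 + n - q * (δ₀ + 1)) (w := a.val % q / 2 + 1) (by omega)
              (by rw [hδ₀, show a.val / q + b * (a.val % q / 2) + δ₀ + 1 = (a.val / q + b * (a.val % q / 2)) + (δ₀ + 1)
                    by omega, Nat.mul_add q (a.val / q + b * (a.val % q / 2)) (δ₀ + 1)]; omega)]
            omega
          · -- beyond the first wrap segment: `δ₀ + 1 = (b−1) + b m + δ''`
            obtain ⟨δ₁, hδ₁⟩ := Nat.exists_eq_add_of_le (show b - 1 ≤ δ₀ + 1 by omega)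
            obtain ⟨m, δ'', hmδ, hδ''b⟩ : ∃ m δ'' : ℕ, b * m + δ'' = δ₁ ∧ δ'' < b :=
              ⟨δ₁ / b, δ₁ % b, Nat.div_add_mod _ _, Nat.mod_lt _ (by omega)⟩
            have hmh : m < h := by
              by_contra hge
              have h' := Nat.mul_le_mul_left b (show h ≤ m by omega)
              omega
            have hC := cover3_identity q b (a.val / q) (a.val % q / 2) m (by omega) (by omega) hbq2
            rw [show q * (a.val / q) + 2 * (a.val % q / 2) + 1 = a.val by omega, ← hnq] at hC
            by_cases hδ''0 : δ'' = 0
            · -- (B) at a small value `q − 1 − 2m ≥ 2`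
              rw [val_sub_natCast_eq a (v := q - 1 - 2 * m) (w := a.val % q / 2 + 1 + m) (by omega)
                (by rw [hδ₀, show a.val / q + b * (a.val % q / 2) + δ₀ + 1 =
                      a.val / q + b * (a.val % q / 2) + (b - 1) + b * m by omega]; exact hC)]
              omega
            · -- (C) between two small values: `q − 1 − 2m + n − q δ''`
              have hqd1 : q ≤ q * δ'' := Nat.le_mul_of_pos_right q (by omega)
              have hw : (a.val % q / 2 + 2 + m) * n = (a.val % q / 2 + 1 + m) * n + n := by ring
              have hqbd : q * δ'' + q ≤ b * q := by
                have := Nat.mul_le_mul_left q (show δ'' + 1 ≤ b by omega)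
                rw [Nat.mul_succ] at this; rw [Nat.mul_comm b]; exact this
              rw [val_sub_natCast_eq a (v := q - 1 - 2 * m + n - q * δ'') (w := a.val % q / 2 + 2 + m) (by omega)
                (by rw [hδ₀, show a.val / q + b * (a.val % q / 2) + δ₀ + 1 =
                      (a.val / q + b * (a.val % q / 2) + (b - 1) + b * m) + δ'' by omega, Nat.mul_add]; omega)]
              omega

end Summit.ResolutionOfSingularities.ResolutionOfSingularities.Theorems.HomologicalConductor.PersistenceCyclicQuotientMinusTwoModQ

end
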